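import Summits.QuantumAdvantage.QuantumAdvantage.Theorems.LinnikCubicClassGroupsDegreeOnePrimesEscapeConjClassShortIntervalDHCorollaries
import Summits.QuantumAdvantage.QuantumAdvantage.Theorems.LinnikCubicClassGroupsDegreeOnePrimesEscapeConjInvariantPNT
import HarnessLib

/-!
# Chebotarev in SHORT INTERVALS in the Linnik range for CONJUGATION-INVARIANT SETS (Deuring–Heilbronn-sharp)

Topic `Summits/QuantumAdvantage/QuantumAdvantage/Theorems`, cell B2b-1 (linnik-cubic), PART A (gen 17); helper
toward the crux `DegreeOnePrimesEscape` (stmt-QuantumAdvantage-11543) of route `LinnikCubicClassGroups`.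
HONEST FRAMING: the value of this file is a THEOREM (kernel-checked, GRH-free, Siegel-free, unconditional) — NOT
summit progress (the route still rests on the hypothesis-type target `PureCubicClassNumberHard`).

**Theorem (`conjInvariant_shortInterval_dh`).**  For `n > 1` and `0 < κ ≤ 1` there are `δ, L, c > 0` such that
every Galois number field `N/ℚ` of degree `n` carries data `θ ∈ {0, 1}`, `β₁ ∈ (1 − c/(log|d_N| + log 4), 1)`,
`K₁ ⊴ G = Gal(N/ℚ)` (`θ = 1`: `ζ_N(β₁) = 0`, `[G : K₁] = 2` and `ζ_{N^H}(β₁) = 0 ↔ H ≤ K₁` — Heilbronn–Stark;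
`θ = 0`: `K₁ = G` and `ζ_N` has no real zero in the window) such that for EVERY conjugation-invariant
`S ⊆ G`, every `x ≥ |d_N|^L` and every `h` with `x^{1−δ} ≤ h ≤ x`,
`|S_S(x+h) − S_S(x) − M_S| ≤ κ M_S`, where `S_S(y) = Σ_{p ≤ y, p ∤ d_N, Frob_p ∈ S} log p` and
`M_S = (|S| h − θ (|S ∩ K₁| − |S ∖ K₁|) I)/|G|`, `I = ((x+h)^{β₁} − x^{β₁})/β₁ = ∫_x^{x+h} t^{β₁−1} dt`.
The error is RELATIVE to the (positive) main term, uniformly in `S` — by summing the Deuring–Heilbronn-sharp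
class theorem `frobeniusClass_shortInterval_dh` over the classes of `S ∩ K₁` (flat, main term `h − I`) and of
`S ∖ K₁` (main term `h + I`).  Corollary `exists_prime_frobenius_mem_set_shortInterval`: every such interval
contains a prime `p ∤ d_N` with `Frob_p ∈ S` (any non-empty conjugation-invariant `S`).
Bookkeeping: `sum_filter_subsetPred_eq_sum` / `sum_subsetPred_split` are the weighted forms of the gen-14 counting
identities `card_filter_subsetPred_eq_sum` / `card_subsetPred_split`.
References: [LagariasMontgomeryOdlyzko1979, Thm. 1.1]; [ThornerZaman2019, Thm. 3.2]; A. Balog, K. Ono, J. Number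
Theory 91 (2001); S. Gun, S. L. Naik, arXiv:2405.04698 (2024), Thm. 7; [Stark1974, Thm. 3].
-/

noncomputable section

open scoped NumberField nonZeroDivisors Classical
open Finset Real Ideal NumberField IsDedekindDomain
open Literature.NumberTheory.NumberFields Literature.NumberTheory.LFunctions
  Literature.NumberTheory.LFunctions.NumberField Literature.NumberTheory.GaloisRepresentations

namespace Summit.QuantumAdvantage.QuantumAdvantage.Theorems.DegreeOnePrimesEscape

variable {N : Type} [Field N] [NumberField N] [IsGalois ℚ N]

/-- **`Σ_{p ≤ m : p ∤ d_N, Frob_p ∈ S} f(p) = Σ_{C ⊆ S} Σ_{p ≤ m : p ∤ d_N, Frob_p ∈ C} f(p)`** for a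
conjugation-invariant `S` (weighted form of `card_filter_subsetPred_eq_sum`). -/
theorem sum_filter_subsetPred_eq_sum {S : Set (N ≃ₐ[ℚ] N)}
    (hS : ∀ g h : N ≃ₐ[ℚ] N, g ∈ S → h * g * h⁻¹ ∈ S)
    (rep : ConjClasses (N ≃ₐ[ℚ] N) → (N ≃ₐ[ℚ] N))
    (hrep : ∀ C ∈ (Finset.univ.filter fun g : N ≃ₐ[ℚ] N => g ∈ S).image ConjClasses.mk,
      ConjClasses.mk (rep C) = C) (m : ℕ) (f : ℕ → ℝ) :
    ∑ p ∈ (Nat.primesLE m).filter (fun p : ℕ => ¬ ((p : ℤ) ∣ NumberField.discr N) ∧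
        ∃ (Q : Ideal (𝓞 N)) (_ : Q.IsMaximal) (_ : Q.LiesOver (span {(p : ℤ)})) (φ : N ≃ₐ[ℚ] N),
          IsArithFrobAt ℤ φ Q ∧ Q.inertia (N ≃ₐ[ℚ] N) = ⊥ ∧ φ ∈ S), f p =
      ∑ C ∈ (Finset.univ.filter fun g : N ≃ₐ[ℚ] N => g ∈ S).image ConjClasses.mk,
        ∑ p ∈ (Nat.primesLE m).filter (fun p : ℕ => ¬ ((p : ℤ) ∣ NumberField.discr N) ∧
          ∃ (Q : Ideal (𝓞 N)) (_ : Q.IsMaximal) (_ : Q.LiesOver (span {(p : ℤ)})) (φ g : N ≃ₐ[ℚ] N),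
            IsArithFrobAt ℤ φ Q ∧ Q.inertia (N ≃ₐ[ℚ] N) = ⊥ ∧ g * φ * g⁻¹ = rep C), f p := by
  -- a Frobenius class function at the primes `p ∤ d_N`
  have key : ∀ p : ℕ, p.Prime → ¬ ((p : ℤ) ∣ NumberField.discr N) → ∃ φ₀ : N ≃ₐ[ℚ] N,
      (∀ σ : N ≃ₐ[ℚ] N,
        (∃ (Q : Ideal (𝓞 N)) (_ : Q.IsMaximal) (_ : Q.LiesOver (span {(p : ℤ)})) (φ g : N ≃ₐ[ℚ] N),
          IsArithFrobAt ℤ φ Q ∧ Q.inertia (N ≃ₐ[ℚ] N) = ⊥ ∧ g * φ * g⁻¹ = σ) ↔ IsConj φ₀ σ) ∧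
      ((∃ (Q : Ideal (𝓞 N)) (_ : Q.IsMaximal) (_ : Q.LiesOver (span {(p : ℤ)})) (φ : N ≃ₐ[ℚ] N),
          IsArithFrobAt ℤ φ Q ∧ Q.inertia (N ≃ₐ[ℚ] N) = ⊥ ∧ φ ∈ S) ↔ φ₀ ∈ S) := by
    intro p hp hpN
    obtain ⟨φ₀, h1, h2⟩ := exists_frobRep (N := N) hp hpN
    exact ⟨φ₀, h1, h2 S hS⟩
  choose! Φ hΦc hΦS using key
  set R := (Finset.univ.filter fun g : N ≃ₐ[ℚ] N => g ∈ S).image ConjClasses.mk with hR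
  set s := (Nat.primesLE m).filter (fun p : ℕ => ¬ ((p : ℤ) ∣ NumberField.discr N) ∧ Φ p ∈ S)
    with hs
  have hL : ((Nat.primesLE m).filter (fun p : ℕ => ¬ ((p : ℤ) ∣ NumberField.discr N) ∧
      ∃ (Q : Ideal (𝓞 N)) (_ : Q.IsMaximal) (_ : Q.LiesOver (span {(p : ℤ)})) (φ : N ≃ₐ[ℚ] N),
        IsArithFrobAt ℤ φ Q ∧ Q.inertia (N ≃ₐ[ℚ] N) = ⊥ ∧ φ ∈ S)) = s := by
    rw [hs]
    refine Finset.filter_congr fun p hp => ?_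
    have hp' := (Nat.mem_primesLE.mp hp).2
    constructor
    · rintro ⟨hpN, h⟩; exact ⟨hpN, (hΦS p hp' hpN).mp h⟩
    · rintro ⟨hpN, h⟩; exact ⟨hpN, (hΦS p hp' hpN).mpr h⟩
  rw [hL]
  have hmaps : ∀ p ∈ s, ConjClasses.mk (Φ p) ∈ R := by
    intro p hp
    have hp' := Finset.mem_filter.mp hp
    rw [hR, Finset.mem_image]
    exact ⟨Φ p, Finset.mem_filter.mpr ⟨Finset.mem_univ _, hp'.2.2⟩, rfl⟩
  rw [← Finset.sum_fiberwise_of_maps_to hmaps]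
  refine Finset.sum_congr rfl fun C hC => ?_
  have hrepC := hrep C hC
  obtain ⟨s₀, hs₀, hs₀C⟩ := Finset.mem_image.mp hC
  rw [Finset.mem_filter] at hs₀
  rw [hs, Finset.filter_filter]
  refine Finset.sum_congr ?_ fun _ _ => rfl
  refine Finset.filter_congr fun p hp => ?_
  have hp' := (Nat.mem_primesLE.mp hp).2
  constructor
  · rintro ⟨⟨hpN, -⟩, hC'⟩
    refine ⟨hpN, (hΦc p hp' hpN (rep C)).mpr ?_⟩
    rw [← ConjClasses.mk_eq_mk_iff_isConj, hC', hrepC]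
  · rintro ⟨hpN, h⟩
    have h1 : IsConj (Φ p) (rep C) := (hΦc p hp' hpN (rep C)).mp h
    have h2 : ConjClasses.mk (Φ p) = C := by
      rw [← hrepC, ConjClasses.mk_eq_mk_iff_isConj]; exact h1
    refine ⟨⟨hpN, ?_⟩, h2⟩
    have h3 : IsConj s₀ (Φ p) := by
      rw [← ConjClasses.mk_eq_mk_iff_isConj, hs₀C, h2]
    exact mem_of_isConj_of_conjInvariant hS hs₀.2 h3

/-- **Summation over the classes of a conjugation-invariant set, short-interval form.**  If every class
`C(σ)`, `σ ∈ S`, obeys `|S_{C(σ)}(y₂) − S_{C(σ)}(y₁) − (|C(σ)|/|G|) m| ≤ ε (|C(σ)|/|G|) m`, then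
`|S_S(y₂) − S_S(y₁) − (|S|/|G|) m| ≤ ε (|S|/|G|) m`. -/
theorem sum_subsetPred_approx {S : Set (N ≃ₐ[ℚ] N)}
    (hS : ∀ g h : N ≃ₐ[ℚ] N, g ∈ S → h * g * h⁻¹ ∈ S) {m₁ m₂ : ℕ} {m ε : ℝ}
    (h : ∀ σ ∈ S,
      |(∑ p ∈ (Nat.primesLE m₂).filter
          (fun p : ℕ => ¬ ((p : ℤ) ∣ NumberField.discr N) ∧
            ∃ (Q : Ideal (𝓞 N)) (_ : Q.IsMaximal) (_ : Q.LiesOver (span {(p : ℤ)})) (φ g : N ≃ₐ[ℚ] N),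
              IsArithFrobAt ℤ φ Q ∧ Q.inertia (N ≃ₐ[ℚ] N) = ⊥ ∧ g * φ * g⁻¹ = σ), Real.log p) -
        (∑ p ∈ (Nat.primesLE m₁).filter
          (fun p : ℕ => ¬ ((p : ℤ) ∣ NumberField.discr N) ∧
            ∃ (Q : Ideal (𝓞 N)) (_ : Q.IsMaximal) (_ : Q.LiesOver (span {(p : ℤ)})) (φ g : N ≃ₐ[ℚ] N),
              IsArithFrobAt ℤ φ Q ∧ Q.inertia (N ≃ₐ[ℚ] N) = ⊥ ∧ g * φ * g⁻¹ = σ), Real.log p) -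
        (Nat.card {τ : N ≃ₐ[ℚ] N // IsConj σ τ} : ℝ) / Nat.card (N ≃ₐ[ℚ] N) * m| ≤
        ε * ((Nat.card {τ : N ≃ₐ[ℚ] N // IsConj σ τ} : ℝ) / Nat.card (N ≃ₐ[ℚ] N) * m)) :
    |(∑ p ∈ (Nat.primesLE m₂).filter
        (fun p : ℕ => ¬ ((p : ℤ) ∣ NumberField.discr N) ∧
          ∃ (Q : Ideal (𝓞 N)) (_ : Q.IsMaximal) (_ : Q.LiesOver (span {(p : ℤ)})) (φ : N ≃ₐ[ℚ] N),
            IsArithFrobAt ℤ φ Q ∧ Q.inertia (N ≃ₐ[ℚ] N) = ⊥ ∧ φ ∈ S), Real.log p) -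
      (∑ p ∈ (Nat.primesLE m₁).filter
        (fun p : ℕ => ¬ ((p : ℤ) ∣ NumberField.discr N) ∧
          ∃ (Q : Ideal (𝓞 N)) (_ : Q.IsMaximal) (_ : Q.LiesOver (span {(p : ℤ)})) (φ : N ≃ₐ[ℚ] N),
            IsArithFrobAt ℤ φ Q ∧ Q.inertia (N ≃ₐ[ℚ] N) = ⊥ ∧ φ ∈ S), Real.log p) -
      (Nat.card S : ℝ) / Nat.card (N ≃ₐ[ℚ] N) * m| ≤
      ε * ((Nat.card S : ℝ) / Nat.card (N ≃ₐ[ℚ] N) * m) := by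
  set R := (Finset.univ.filter fun g : N ≃ₐ[ℚ] N => g ∈ S).image ConjClasses.mk with hR
  have hrepex : ∀ C ∈ R, ∃ σ : N ≃ₐ[ℚ] N, σ ∈ S ∧ ConjClasses.mk σ = C := by
    intro C hC
    obtain ⟨s, hs, hsC⟩ := Finset.mem_image.mp hC
    exact ⟨s, (Finset.mem_filter.mp hs).2, hsC⟩
  choose! rep hrepS hrepC using hrepex
  rw [sum_filter_subsetPred_eq_sum hS rep hrepC m₂, sum_filter_subsetPred_eq_sum hS rep hrepC m₁]
  -- `|S| = Σ_C |C|`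
  have hcardS : (Nat.card S : ℝ) = ∑ C ∈ R, (Nat.card {τ : N ≃ₐ[ℚ] N // IsConj (rep C) τ} : ℝ) := by
    rw [← sum_natCard_mk_eq hS]
    push_cast
    exact Finset.sum_congr rfl fun C hC => by rw [natCard_isConj_eq_natCard_mk_eq (hrepC C hC)]
  set T : ℕ → ConjClasses (N ≃ₐ[ℚ] N) → ℝ := fun k C =>
    ∑ p ∈ (Nat.primesLE k).filter
      (fun p : ℕ => ¬ ((p : ℤ) ∣ NumberField.discr N) ∧
        ∃ (Q : Ideal (𝓞 N)) (_ : Q.IsMaximal) (_ : Q.LiesOver (span {(p : ℤ)})) (φ g : N ≃ₐ[ℚ] N),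
          IsArithFrobAt ℤ φ Q ∧ Q.inertia (N ≃ₐ[ℚ] N) = ⊥ ∧ g * φ * g⁻¹ = rep C), Real.log p
    with hT
  set δ : ConjClasses (N ≃ₐ[ℚ] N) → ℝ := fun C =>
    (Nat.card {τ : N ≃ₐ[ℚ] N // IsConj (rep C) τ} : ℝ) / Nat.card (N ≃ₐ[ℚ] N) with hδ
  have hTC : ∀ C ∈ R, |T m₂ C - T m₁ C - δ C * m| ≤ ε * (δ C * m) := fun C hC => h (rep C) (hrepS C hC)
  have hsumδ : (Nat.card S : ℝ) / Nat.card (N ≃ₐ[ℚ] N) * m = ∑ C ∈ R, δ C * m := by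
    rw [hcardS, Finset.sum_div, Finset.sum_mul]
  have e : (∑ C ∈ R, T m₂ C) - (∑ C ∈ R, T m₁ C) - ∑ C ∈ R, δ C * m =
      ∑ C ∈ R, (T m₂ C - T m₁ C - δ C * m) := by
    rw [Finset.sum_sub_distrib, Finset.sum_sub_distrib]
  show |(∑ C ∈ R, T m₂ C) - (∑ C ∈ R, T m₁ C) - (Nat.card S : ℝ) / Nat.card (N ≃ₐ[ℚ] N) * m| ≤
      ε * ((Nat.card S : ℝ) / Nat.card (N ≃ₐ[ℚ] N) * m)
  rw [hsumδ, e]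
  calc |∑ C ∈ R, (T m₂ C - T m₁ C - δ C * m)| ≤ ∑ C ∈ R, |T m₂ C - T m₁ C - δ C * m| :=
        Finset.abs_sum_le_sum_abs _ _
    _ ≤ ∑ C ∈ R, ε * (δ C * m) := Finset.sum_le_sum hTC
    _ = ε * ∑ C ∈ R, δ C * m := by rw [Finset.mul_sum]

/-- Splitting the weighted count along a subgroup: `S_S = S_{S ∩ K} + S_{S ∖ K}` (weighted form of
`card_subsetPred_split`). -/
theorem sum_subsetPred_split (S : Set (N ≃ₐ[ℚ] N)) (K : Subgroup (N ≃ₐ[ℚ] N)) [hK : K.Normal]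
    (s : Finset ℕ) (hs : ∀ p ∈ s, p.Prime) (f : ℕ → ℝ) :
    ∑ p ∈ s.filter (fun p : ℕ => ¬ ((p : ℤ) ∣ NumberField.discr N) ∧
        ∃ (Q : Ideal (𝓞 N)) (_ : Q.IsMaximal) (_ : Q.LiesOver (span {(p : ℤ)})) (φ : N ≃ₐ[ℚ] N),
          IsArithFrobAt ℤ φ Q ∧ Q.inertia (N ≃ₐ[ℚ] N) = ⊥ ∧ φ ∈ S), f p =
      (∑ p ∈ s.filter (fun p : ℕ => ¬ ((p : ℤ) ∣ NumberField.discr N) ∧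
        ∃ (Q : Ideal (𝓞 N)) (_ : Q.IsMaximal) (_ : Q.LiesOver (span {(p : ℤ)})) (φ : N ≃ₐ[ℚ] N),
          IsArithFrobAt ℤ φ Q ∧ Q.inertia (N ≃ₐ[ℚ] N) = ⊥ ∧
            φ ∈ {g : N ≃ₐ[ℚ] N | g ∈ S ∧ g ∈ K}), f p) +
      ∑ p ∈ s.filter (fun p : ℕ => ¬ ((p : ℤ) ∣ NumberField.discr N) ∧
        ∃ (Q : Ideal (𝓞 N)) (_ : Q.IsMaximal) (_ : Q.LiesOver (span {(p : ℤ)})) (φ : N ≃ₐ[ℚ] N),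
          IsArithFrobAt ℤ φ Q ∧ Q.inertia (N ≃ₐ[ℚ] N) = ⊥ ∧
            φ ∈ {g : N ≃ₐ[ℚ] N | g ∈ S ∧ g ∉ K}), f p := by
  have key : ∀ p : ℕ, p.Prime → ¬ ((p : ℤ) ∣ NumberField.discr N) → ∃ φ₀ : N ≃ₐ[ℚ] N,
      ∀ (Q : Ideal (𝓞 N)) (_ : Q.IsMaximal) (_ : Q.LiesOver (span {(p : ℤ)})) (φ : N ≃ₐ[ℚ] N),
        IsArithFrobAt ℤ φ Q → IsConj φ₀ φ := by
    intro p hp hpN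
    obtain ⟨Q₀, hQ₀, hQ₀p, ⟨φ₀, hφ₀⟩, hI₀⟩ := exists_isArithFrobAt_of_not_dvd_discr (N := N) hp hpN
    exact ⟨φ₀, fun Q hQ hQp φ hφ => isConj_of_isArithFrobAt hQ₀ hQ₀p hQ hQp hφ₀ hI₀ hφ⟩
  rw [← Finset.sum_filter_add_sum_filter_not _ (fun p : ℕ =>
    ∃ (Q : Ideal (𝓞 N)) (_ : Q.IsMaximal) (_ : Q.LiesOver (span {(p : ℤ)})) (φ : N ≃ₐ[ℚ] N),
      IsArithFrobAt ℤ φ Q ∧ Q.inertia (N ≃ₐ[ℚ] N) = ⊥ ∧ φ ∈ {g : N ≃ₐ[ℚ] N | g ∈ S ∧ g ∈ K})]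
  rw [Finset.filter_filter, Finset.filter_filter]
  congr 1
  · refine Finset.sum_congr ?_ fun _ _ => rfl
    refine Finset.filter_congr fun p hp => ?_
    constructor
    · rintro ⟨⟨hpN, -⟩, h2⟩; exact ⟨hpN, h2⟩
    · rintro ⟨hpN, Q, hQ, hQp, φ, hφ, hI, hφS⟩
      exact ⟨⟨hpN, Q, hQ, hQp, φ, hφ, hI, hφS.1⟩, Q, hQ, hQp, φ, hφ, hI, hφS⟩
  · refine Finset.sum_congr ?_ fun _ _ => rfl
    refine Finset.filter_congr fun p hp => ?_
    constructor
    · rintro ⟨⟨hpN, Q, hQ, hQp, φ, hφ, hI, hφS⟩, h2⟩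
      refine ⟨hpN, Q, hQ, hQp, φ, hφ, hI, hφS, fun hφK => h2 ⟨Q, hQ, hQp, φ, hφ, hI, hφS, hφK⟩⟩
    · rintro ⟨hpN, Q, hQ, hQp, φ, hφ, hI, hφS⟩
      refine ⟨⟨hpN, Q, hQ, hQp, φ, hφ, hI, hφS.1⟩, ?_⟩
      rintro ⟨Q', hQ', hQ'p, φ', hφ', -, hφ'S⟩
      obtain ⟨φ₀, hφ₀⟩ := key p (hs p hp) hpN
      have h1 : IsConj φ φ' :=
        (hφ₀ Q hQ hQp φ hφ).symm.trans (hφ₀ Q' hQ' hQ'p φ' hφ')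
      obtain ⟨c, hc⟩ := isConj_iff.mp h1
      apply hφS.2
      have h2 := hK.conj_mem φ' hφ'S.2 c⁻¹
      have h3 : c⁻¹ * φ' * c⁻¹⁻¹ = φ := by rw [← hc]; group
      rwa [h3] at h2

/-- Relative error survives enlarging the main term: `|a − A| ≤ ε B`, `B ≤ A`, `0 ≤ ε` ⟹ `|a − A| ≤ ε A`. -/
theorem abs_sub_le_rel_of_le {a A B ε : ℝ} (h : |a - A| ≤ ε * B) (hBA : B ≤ A) (hε : 0 ≤ ε) :
    |a - A| ≤ ε * A :=
  h.trans (mul_le_mul_of_nonneg_left hBA hε)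

set_option maxHeartbeats 4000000 in
/-- **Chebotarev in short intervals in the Linnik range for a conjugation-invariant set, Deuring–Heilbronn-sharp**
(see the module docstring): for `n > 1`, `0 < κ ≤ 1` there are `δ ≤ 1/64`, `L`, `c ≤ min(1/4, 1/(8(2n)!))`
such that every Galois `N` of degree `n` has data `θ ∈ {0,1}`, `β₁`, `K₁ ⊴ Gal(N/ℚ)` (as in
`conjInvariant_PNT_pi`) with: for every conjugation-invariant `S ⊆ Gal(N/ℚ)`, every `x ≥ |d_N|^L` and every
`x^{1−δ} ≤ h ≤ x`, `|S_S(x+h) − S_S(x) − M_S| ≤ κ M_S`,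
`M_S = (|S| h − θ (|S ∩ K₁| − |S ∖ K₁|) ((x+h)^{β₁} − x^{β₁})/β₁)/|G|`.  Unconditional.
[cite: LagariasMontgomeryOdlyzko1979, Theorem 1.1] [cite: ThornerZaman2019, Theorem 3.2] -/
theorem conjInvariant_shortInterval_dh (n : ℕ) (hn : 1 < n) {κ : ℝ} (hκ : 0 < κ) (hκ1 : κ ≤ 1) :
    ∃ δ L c : ℝ, 0 < δ ∧ δ ≤ 1 / 64 ∧ 0 < L ∧ 0 < c ∧ c ≤ 1 / 4 ∧ c ≤ 1 / (8 * ((2 * n).factorial : ℝ)) ∧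
      ∀ (N : Type) [Field N] [NumberField N] [IsGalois ℚ N], Module.finrank ℚ N = n →
      ∃ (θ β₁ : ℝ) (K₁ : Subgroup (N ≃ₐ[ℚ] N)), (θ = 0 ∨ θ = 1) ∧ K₁.Normal ∧
        1 - c / (Real.log ((NumberField.discr N).natAbs : ℝ) + Real.log 4) < β₁ ∧ β₁ < 1 ∧
        (θ = 1 → dedekindZeta₁ N β₁ = 0 ∧ K₁.index = 2 ∧
          ∀ H : Subgroup (N ≃ₐ[ℚ] N),
            dedekindZeta₁ (IntermediateField.fixedField H) β₁ = 0 ↔ H ≤ K₁) ∧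
        (θ = 0 → K₁ = ⊤ ∧ ¬ ∃ β : ℝ, dedekindZeta₁ N β = 0 ∧
          1 - c / (Real.log ((NumberField.discr N).natAbs : ℝ) + Real.log 4) < β ∧ β < 1) ∧
        ∀ S : Set (N ≃ₐ[ℚ] N), (∀ g g' : N ≃ₐ[ℚ] N, g ∈ S → g' * g * g'⁻¹ ∈ S) →
          ∀ x h : ℝ, ((NumberField.discr N).natAbs : ℝ) ^ L ≤ x → x ^ (1 - δ) ≤ h → h ≤ x →
            |(∑ p ∈ (Nat.primesLE ⌊x + h⌋₊).filter
                (fun p : ℕ => ¬ ((p : ℤ) ∣ NumberField.discr N) ∧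
                  ∃ (Q : Ideal (𝓞 N)) (_ : Q.IsMaximal) (_ : Q.LiesOver (span {(p : ℤ)})) (φ : N ≃ₐ[ℚ] N),
                    IsArithFrobAt ℤ φ Q ∧ Q.inertia (N ≃ₐ[ℚ] N) = ⊥ ∧ φ ∈ S), Real.log p) -
              (∑ p ∈ (Nat.primesLE ⌊x⌋₊).filter
                (fun p : ℕ => ¬ ((p : ℤ) ∣ NumberField.discr N) ∧
                  ∃ (Q : Ideal (𝓞 N)) (_ : Q.IsMaximal) (_ : Q.LiesOver (span {(p : ℤ)})) (φ : N ≃ₐ[ℚ] N),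
                    IsArithFrobAt ℤ φ Q ∧ Q.inertia (N ≃ₐ[ℚ] N) = ⊥ ∧ φ ∈ S), Real.log p) -
              ((Nat.card S : ℝ) * h -
                θ * ((Nat.card {g : N ≃ₐ[ℚ] N // g ∈ S ∧ g ∈ K₁} : ℝ) -
                  Nat.card {g : N ≃ₐ[ℚ] N // g ∈ S ∧ g ∉ K₁}) * (((x + h) ^ β₁ - x ^ β₁) / β₁)) /
                Nat.card (N ≃ₐ[ℚ] N)| ≤
              κ * (((Nat.card S : ℝ) * h -
                θ * ((Nat.card {g : N ≃ₐ[ℚ] N // g ∈ S ∧ g ∈ K₁} : ℝ) -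
                  Nat.card {g : N ≃ₐ[ℚ] N // g ∈ S ∧ g ∉ K₁}) * (((x + h) ^ β₁ - x ^ β₁) / β₁)) /
                Nat.card (N ≃ₐ[ℚ] N)) := by
  obtain ⟨δ, L, c, hδ0, hδ64, hL, hc, hc4, hcF, hmain⟩ := frobeniusClass_shortInterval_dh n hn hκ hκ1
  refine ⟨δ, L, c, hδ0, hδ64, hL, hc, hc4, hcF, fun N _ _ _ hN => ?_⟩
  have hN1 : 1 < Module.finrank ℚ N := by rw [hN]; exact hn
  have hd3 : (3 : ℝ) ≤ ((NumberField.discr N).natAbs : ℝ) := three_le_natAbs_discr_real N hN1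
  have hℓ : 1 < Real.log ((NumberField.discr N).natAbs : ℝ) + Real.log 4 := by
    have h1 := Real.log_pos (by linarith : (1 : ℝ) < ((NumberField.discr N).natAbs : ℝ))
    have h2 : 1 < Real.log 4 := by
      have h := Real.log_two_gt_d9
      have e : Real.log 4 = 2 * Real.log 2 := by
        rw [show (4 : ℝ) = 2 ^ 2 by norm_num, Real.log_pow]; push_cast; ring
      rw [e]; linarith
    linarith
  have hℓ0 : 0 < Real.log ((NumberField.discr N).natAbs : ℝ) + Real.log 4 := by linarith
  -- positivity of `x`, `h` in the range
  have hxpos : ∀ x h : ℝ, ((NumberField.discr N).natAbs : ℝ) ^ L ≤ x → x ^ (1 - δ) ≤ h →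
      1 ≤ x ∧ 0 ≤ h := by
    intro x h hx hhx
    have h1 : (3 : ℝ) ^ L ≤ ((NumberField.discr N).natAbs : ℝ) ^ L :=
      Real.rpow_le_rpow (by norm_num) hd3 hL.le
    have h2 : (1 : ℝ) < (3 : ℝ) ^ L := Real.one_lt_rpow (by norm_num) hL
    have hx1 : 1 ≤ x := by linarith
    exact ⟨hx1, (Real.rpow_pos_of_pos (by linarith) _).le.trans hhx⟩
  by_cases hexc : ∃ β₁ : ℝ, dedekindZeta₁ N β₁ = 0 ∧
      1 - c / (Real.log ((NumberField.discr N).natAbs : ℝ) + Real.log 4) < β₁ ∧ β₁ < 1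
  · -- the exceptional case: `θ = 1`, `K₁` from Heilbronn–Stark
    obtain ⟨β₁, hζ₁, hβ₁c, hβ₁1⟩ := hexc
    obtain ⟨K₁, hK₁, hiff⟩ := exists_index_two_of_exceptional hN1 hc4 hζ₁ hβ₁c hβ₁1
    haveI hK₁n : K₁.Normal := Subgroup.normal_of_index_eq_two hK₁
    refine ⟨1, β₁, K₁, Or.inr rfl, hK₁n, hβ₁c, hβ₁1, fun _ => ⟨hζ₁, hK₁, hiff⟩,
      fun h0 => absurd h0 one_ne_zero, fun S hS x h hx hhx hhx' => ?_⟩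
    have hzeta_iff : ∀ σ : N ≃ₐ[ℚ] N,
        dedekindZeta₁ (IntermediateField.fixedField (Subgroup.zpowers σ)) β₁ = 0 ↔ σ ∈ K₁ := by
      intro σ; rw [hiff, Subgroup.zpowers_le]
    obtain ⟨hx1, hh0⟩ := hxpos x h hx hhx
    have hβ₁0 : 0 < β₁ := by
      have : c / (Real.log ((NumberField.discr N).natAbs : ℝ) + Real.log 4) < 1 := by
        rw [div_lt_one hℓ0]; linarith
      linarith
    set I : ℝ := ((x + h) ^ β₁ - x ^ β₁) / β₁ with hI
    have hI0 : 0 ≤ I := (rpow_window_div_mem hx1 hh0 hβ₁0 hβ₁1.le).1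
    -- the part inside `K₁`: flat main term `h − I`, relative error
    have hP : |(∑ p ∈ (Nat.primesLE ⌊x + h⌋₊).filter
        (fun p : ℕ => ¬ ((p : ℤ) ∣ NumberField.discr N) ∧
          ∃ (Q : Ideal (𝓞 N)) (_ : Q.IsMaximal) (_ : Q.LiesOver (span {(p : ℤ)})) (φ : N ≃ₐ[ℚ] N),
            IsArithFrobAt ℤ φ Q ∧ Q.inertia (N ≃ₐ[ℚ] N) = ⊥ ∧
              φ ∈ {g : N ≃ₐ[ℚ] N | g ∈ S ∧ g ∈ K₁}), Real.log p) -
        (∑ p ∈ (Nat.primesLE ⌊x⌋₊).filter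
        (fun p : ℕ => ¬ ((p : ℤ) ∣ NumberField.discr N) ∧
          ∃ (Q : Ideal (𝓞 N)) (_ : Q.IsMaximal) (_ : Q.LiesOver (span {(p : ℤ)})) (φ : N ≃ₐ[ℚ] N),
            IsArithFrobAt ℤ φ Q ∧ Q.inertia (N ≃ₐ[ℚ] N) = ⊥ ∧
              φ ∈ {g : N ≃ₐ[ℚ] N | g ∈ S ∧ g ∈ K₁}), Real.log p) -
        (Nat.card {g : N ≃ₐ[ℚ] N // g ∈ S ∧ g ∈ K₁} : ℝ) / Nat.card (N ≃ₐ[ℚ] N) * (h - I)| ≤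
        κ * ((Nat.card {g : N ≃ₐ[ℚ] N // g ∈ S ∧ g ∈ K₁} : ℝ) / Nat.card (N ≃ₐ[ℚ] N) * (h - I)) :=
      sum_subsetPred_approx (conjInvariant_inter_of_normal hS K₁) (m := h - I)
        (fun σ hσ => ((hmain N hN σ x h hx hhx hhx').2 β₁ hζ₁ hβ₁c hβ₁1).1 ((hzeta_iff σ).mpr hσ.2))
    -- the part outside `K₁`: main term `h + I`, error `κ δ h ≤ κ δ (h + I)`
    have hM : |(∑ p ∈ (Nat.primesLE ⌊x + h⌋₊).filter
        (fun p : ℕ => ¬ ((p : ℤ) ∣ NumberField.discr N) ∧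
          ∃ (Q : Ideal (𝓞 N)) (_ : Q.IsMaximal) (_ : Q.LiesOver (span {(p : ℤ)})) (φ : N ≃ₐ[ℚ] N),
            IsArithFrobAt ℤ φ Q ∧ Q.inertia (N ≃ₐ[ℚ] N) = ⊥ ∧
              φ ∈ {g : N ≃ₐ[ℚ] N | g ∈ S ∧ g ∉ K₁}), Real.log p) -
        (∑ p ∈ (Nat.primesLE ⌊x⌋₊).filter
        (fun p : ℕ => ¬ ((p : ℤ) ∣ NumberField.discr N) ∧
          ∃ (Q : Ideal (𝓞 N)) (_ : Q.IsMaximal) (_ : Q.LiesOver (span {(p : ℤ)})) (φ : N ≃ₐ[ℚ] N),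
            IsArithFrobAt ℤ φ Q ∧ Q.inertia (N ≃ₐ[ℚ] N) = ⊥ ∧
              φ ∈ {g : N ≃ₐ[ℚ] N | g ∈ S ∧ g ∉ K₁}), Real.log p) -
        (Nat.card {g : N ≃ₐ[ℚ] N // g ∈ S ∧ g ∉ K₁} : ℝ) / Nat.card (N ≃ₐ[ℚ] N) * (h + I)| ≤
        κ * ((Nat.card {g : N ≃ₐ[ℚ] N // g ∈ S ∧ g ∉ K₁} : ℝ) / Nat.card (N ≃ₐ[ℚ] N) * (h + I)) := by
      refine sum_subsetPred_approx (conjInvariant_diff_of_normal hS K₁) (m := h + I) fun σ hσ => ?_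
      have h1 := ((hmain N hN σ x h hx hhx hhx').2 β₁ hζ₁ hβ₁c hβ₁1).2
        (fun h0 => hσ.2 ((hzeta_iff σ).mp h0))
      have hδσ : 0 ≤ (Nat.card {τ : N ≃ₐ[ℚ] N // IsConj σ τ} : ℝ) / Nat.card (N ≃ₐ[ℚ] N) := by
        positivity
      exact abs_sub_le_rel_of_le h1 (mul_le_mul_of_nonneg_left (by linarith) hδσ) hκ.le
    have hsplit₂ := sum_subsetPred_split S K₁ (Nat.primesLE ⌊x + h⌋₊)
      (fun p hp => (Nat.mem_primesLE.mp hp).2) (fun p : ℕ => Real.log p)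
    have hsplit₁ := sum_subsetPred_split S K₁ (Nat.primesLE ⌊x⌋₊)
      (fun p hp => (Nat.mem_primesLE.mp hp).2) (fun p : ℕ => Real.log p)
    have hcs : (Nat.card S : ℝ) = (Nat.card {g : N ≃ₐ[ℚ] N // g ∈ S ∧ g ∈ K₁} : ℝ) +
        Nat.card {g : N ≃ₐ[ℚ] N // g ∈ S ∧ g ∉ K₁} := by
      exact_mod_cast natCard_set_eq_add S K₁
    have key := abs_add_sub_add_le_of_rel hP hM
    have e : ((Nat.card S : ℝ) * h -
        1 * ((Nat.card {g : N ≃ₐ[ℚ] N // g ∈ S ∧ g ∈ K₁} : ℝ) -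
          Nat.card {g : N ≃ₐ[ℚ] N // g ∈ S ∧ g ∉ K₁}) * I) / Nat.card (N ≃ₐ[ℚ] N) =
        (Nat.card {g : N ≃ₐ[ℚ] N // g ∈ S ∧ g ∈ K₁} : ℝ) / Nat.card (N ≃ₐ[ℚ] N) * (h - I) +
        (Nat.card {g : N ≃ₐ[ℚ] N // g ∈ S ∧ g ∉ K₁} : ℝ) / Nat.card (N ≃ₐ[ℚ] N) * (h + I) := by
      rw [hcs]; ring
    rw [e, hsplit₂, hsplit₁]
    have e2 : ∀ a b a' b' A B : ℝ, a + b - (a' + b') - (A + B) = (a - a') + (b - b') - (A + B) := by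
      intros; ring
    rw [e2]
    exact key
  · -- no exceptional zero: `θ = 0`, `K₁ = G`
    refine ⟨0, 1 - c / (2 * (Real.log ((NumberField.discr N).natAbs : ℝ) + Real.log 4)), ⊤, Or.inl rfl,
      inferInstance, ?_, ?_, fun h1 => absurd h1.symm one_ne_zero, fun _ => ⟨rfl, hexc⟩,
      fun S hS x h hx hhx hhx' => ?_⟩
    · have : c / (2 * (Real.log ((NumberField.discr N).natAbs : ℝ) + Real.log 4)) <
          c / (Real.log ((NumberField.discr N).natAbs : ℝ) + Real.log 4) := by
        rw [div_lt_div_iff_of_pos_left hc (by positivity) hℓ0]; linarith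
      linarith
    · have : 0 < c / (2 * (Real.log ((NumberField.discr N).natAbs : ℝ) + Real.log 4)) := by positivity
      linarith
    have hA := sum_subsetPred_approx hS (m := h)
      (fun σ hσ => (hmain N hN σ x h hx hhx hhx').1 hexc)
    have e : ((Nat.card S : ℝ) * h -
        0 * ((Nat.card {g : N ≃ₐ[ℚ] N // g ∈ S ∧ g ∈ (⊤ : Subgroup (N ≃ₐ[ℚ] N))} : ℝ) -
          Nat.card {g : N ≃ₐ[ℚ] N // g ∈ S ∧ g ∉ (⊤ : Subgroup (N ≃ₐ[ℚ] N))}) *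
          (((x + h) ^ (1 - c / (2 * (Real.log ((NumberField.discr N).natAbs : ℝ) + Real.log 4))) -
            x ^ (1 - c / (2 * (Real.log ((NumberField.discr N).natAbs : ℝ) + Real.log 4)))) /
            (1 - c / (2 * (Real.log ((NumberField.discr N).natAbs : ℝ) + Real.log 4))))) /
          Nat.card (N ≃ₐ[ℚ] N) =
        (Nat.card S : ℝ) / Nat.card (N ≃ₐ[ℚ] N) * h := by ring
    rw [e]
    exact hA

/-- **A prime with Frobenius in a prescribed conjugation-invariant set in every short interval of the Linnik
range** — every Galois `N/ℚ`, every non-empty conjugation-invariant `S ⊆ Gal(N/ℚ)`, every `x ≥ |d_N|^L` and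
`x^{1−δ} ≤ h ≤ x`, unconditionally (from `exists_prime_frobenius_mem_shortInterval_all`). -/
theorem exists_prime_frobenius_mem_set_shortInterval (n : ℕ) (hn : 1 < n) :
    ∃ δ L : ℝ, 0 < δ ∧ δ ≤ 1 / 64 ∧ 0 < L ∧
      ∀ (N : Type) [Field N] [NumberField N] [IsGalois ℚ N], Module.finrank ℚ N = n →
      ∀ S : Set (N ≃ₐ[ℚ] N), (∀ g g' : N ≃ₐ[ℚ] N, g ∈ S → g' * g * g'⁻¹ ∈ S) → S.Nonempty →
      ∀ x h : ℝ, ((NumberField.discr N).natAbs : ℝ) ^ L ≤ x → x ^ (1 - δ) ≤ h → h ≤ x →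
        ∃ p : ℕ, p.Prime ∧ x < p ∧ (p : ℝ) ≤ x + h ∧ ¬ ((p : ℤ) ∣ NumberField.discr N) ∧
          ∃ (Q : Ideal (𝓞 N)) (_ : Q.IsMaximal) (_ : Q.LiesOver (span {(p : ℤ)})) (φ : N ≃ₐ[ℚ] N),
            IsArithFrobAt ℤ φ Q ∧ Q.inertia (N ≃ₐ[ℚ] N) = ⊥ ∧ φ ∈ S := by
  obtain ⟨δ, L, hδ0, hδ64, hL0, hmain⟩ := exists_prime_frobenius_mem_shortInterval_all n hn
  refine ⟨δ, L, hδ0, hδ64, hL0, fun N _ _ _ hN S hS hSne x h hx hhx hhx' => ?_⟩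
  obtain ⟨σ, hσ⟩ := hSne
  obtain ⟨p, hp, hxp, hpx, hpN, Q, hQ, hQp, φ, g, hφ, hI, hg⟩ := hmain N hN σ x h hx hhx hhx'
  refine ⟨p, hp, hxp, hpx, hpN, Q, hQ, hQp, φ, hφ, hI, ?_⟩
  have h1 := hS σ g⁻¹ hσ
  have e : g⁻¹ * σ * g⁻¹⁻¹ = φ := by rw [← hg]; group
  rwa [e] at h1

end Summit.QuantumAdvantage.QuantumAdvantage.Theorems.DegreeOnePrimesEscape

end
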